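import Summits.Ventures.YMGap.Thresholds.ConnectedFourPointBounds
import HarnessLib

/-!
# Venture YMGap — C-SUS4 groundwork: TREE DECAY OF THE CONNECTED FOUR-POINT FUNCTION of the `SU(2)`, `d = 4`
# strong-coupling state (every `0 ≤ β_W ≤ β₁ ≤ 9/25`), one constant for the whole window

HONEST FRAMING: venture file of the cell `pub-ymgap` (QuantumFields programme), seat ds-1 (gen 10).  Strong-coupling LATTICE
statements for `SU(2)` lattice Yang–Mills on `ℤ^4` with the Wilson action inside the one-sided vertex-star window; cumulant
estimates of the unique DLR state only; nothing about the continuum or the Clay problem.  Successor input for «C³ of the state /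
C⁴ of the pressure» (memo HOME/ds/ds1g10/NEXT-CDIFF3.md).

* `three_mul_max_gap_ge` — single-linkage geometry of four points: if the four bipartition gaps `g₁ = min(d₀₁,d₁₂,d₁₃)`,
  `g₁₂ = min(d₀₁,d₀₂,d₁₃,d₂₃)`, `g₁₃ = min(d₀₁,d₀₃,d₁₂,d₂₃)`, `g₁₂₃ = min(d₀₁,d₀₂,d₀₃)` are all `≤ G`, then `d₀₁ ≤ 3G`
  (triangle inequality; the threshold graph at level `G` is connected);
* ★ `su2_abs_fourPoint_le` — TREE DECAY: for a Lipschitz cylinder `F` (support `Λ` within `D` of `x₀`) and all plaquettes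
  `q, r, s`: `|u₄(F; W_q; W_r; W_s)| ≤ A₄ · ρ^{‖x₀−x_q‖₁} ρ^{‖x₀−x_r‖₁} ρ^{‖x₀−x_s‖₁}`, `ρ = e^{−κ/36}`, ONE explicit
  `A₄ = 4(2√2)² e^{κ(D+4)} · 40 n²M²L²` (`n = #Λ + 4`, `L = K + 32`, `M = |F 1| + 2K + 1`) — the seven bipartitions of the four
  slots (`su2_abs_fourPoint_le_of_isolated/_of_pair` through the transpositions of `ConnectedFourPointAlgebra`) and
  `three_mul_max_gap_ge`;
* ★ `su2_summable_fourPoint` — `(r, s) ↦ u₄(F; W_q; W_r; W_s)` bounds: `Σ_r Σ_s |u₄| ≤ A₄ G₄² ρ^{‖x₀−x_q‖₁}` with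
  `G₄ = D₄((1+ρ)/(1−ρ))⁴`, summable again in `q` — the fourth-order static response is FINITE on the window.
-/

noncomputable section

open MeasureTheory ProbabilityTheory Function Finset Filter Topology Real Set
open scoped NNReal
open Literature.MathematicalPhysics.QuantumLattice (LGConfig ZdEdge ZdPlaquette plaquetteEdges fundamentalRep ymGibbsMeasures)
open Literature.MathematicalPhysics.QuantumFieldTheory hiding ZdEdge
open Summit.Ventures.YMGap.DSWindow (starRate starRate_pos)
open Summit.Ventures.YMGap.StarWindowGauge (gaugeR gaugeR_lt_one_of_le)
open Summit.Ventures.YMGap.StarLemmaG (gaugeR_nonneg)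
open Summit.Ventures.YMGap.RobustBall (l1 l1_sub_comm numOrient)
open Summit.Ventures.YMGap.LinearResponseBound (summable_and_tsum_base_le)

namespace Summit.Ventures.YMGap.CouplingResponse

/-! ### §1 Geometry of four points -/

section Geometry

/-- **Single-linkage bound for four points**: with pairwise distances `dᵢⱼ` satisfying the triangle inequalities through
`P₀`, if the gaps of all seven bipartitions of `{P₀, P₁, P₂, P₃}` are `≤ G`, then `d₀ᵢ ≤ 3G` for `i = 1, 2, 3` (the threshold
graph at level `G` is connected). [folklore] -/
theorem dist_le_three_mul_of_gaps_le {d01 d02 d03 d12 d13 d23 G : ℝ}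
    (t12 : d01 ≤ d02 + d12) (t13 : d01 ≤ d03 + d13) (t21 : d02 ≤ d01 + d12) (t23 : d02 ≤ d03 + d23)
    (t31 : d03 ≤ d01 + d13) (t32 : d03 ≤ d02 + d23)
    (hG1 : min d01 (min d12 d13) ≤ G) (hG2 : min d02 (min d12 d23) ≤ G) (hG3 : min d03 (min d13 d23) ≤ G)
    (hG12 : min d01 (min d02 (min d13 d23)) ≤ G) (hG13 : min d01 (min d03 (min d12 d23)) ≤ G)
    (hG23 : min d02 (min d03 (min d12 d13)) ≤ G) (hG123 : min d01 (min d02 d03) ≤ G) (hG : 0 ≤ G) :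
    d01 ≤ 3 * G ∧ d02 ≤ 3 * G ∧ d03 ≤ 3 * G := by
  simp only [min_le_iff] at hG1 hG2 hG3 hG12 hG13 hG23 hG123
  refine ⟨?_, ?_, ?_⟩
  · rcases hG123 with h | h | h
    · linarith
    · rcases hG13 with h' | h' | h' | h'
      · linarith
      · rcases hG1 with h'' | h'' | h'' <;> linarith
      · linarith
      · rcases hG1 with h'' | h'' | h'' <;> linarith
    · rcases hG12 with h' | h' | h' | h'
      · linarith
      · rcases hG1 with h'' | h'' | h'' <;> linarith
      · linarith
      · rcases hG1 with h'' | h'' | h'' <;> linarith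
  · rcases hG123 with h | h | h
    · -- `d01 ≤ G`
      rcases hG23 with h' | h' | h' | h'
      · linarith
      · rcases hG2 with h'' | h'' | h'' <;> linarith
      · linarith
      · rcases hG2 with h'' | h'' | h'' <;> linarith
    · linarith
    · rcases hG12 with h' | h' | h' | h'
      · rcases hG2 with h'' | h'' | h'' <;> linarith
      · linarith
      · rcases hG2 with h'' | h'' | h'' <;> linarith
      · linarith
  · rcases hG123 with h | h | h
    · rcases hG23 with h' | h' | h' | h'
      · rcases hG3 with h'' | h'' | h'' <;> linarith
      · linarith
      · rcases hG3 with h'' | h'' | h'' <;> linarith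
      · linarith
    · rcases hG13 with h' | h' | h' | h'
      · rcases hG3 with h'' | h'' | h'' <;> linarith
      · linarith
      · rcases hG3 with h'' | h'' | h'' <;> linarith
      · linarith
    · linarith

end Geometry

/-! ### §2 Seven splits ⇒ product decay (pure bookkeeping) -/

section Seven

/-- **Seven splits ⇒ product decay**: if `T ≤ P e^{−κ g_S}` for the seven bipartition gaps `g_S` of the base points
`P₀, P₁, P₂, P₃` (natural sup-norm distances `dᵢⱼ` obeying the triangle inequalities through `P₀`), then
`T ≤ P e^{−(κ/9)d₀₁} e^{−(κ/9)d₀₂} e^{−(κ/9)d₀₃}`. [folklore] -/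
theorem tree_bound_of_seven_splits {T P κ : ℝ} {d01 d02 d03 d12 d13 d23 : ℕ} (hP : 0 ≤ P) (hκ : 0 ≤ κ)
    (t12 : d01 ≤ d02 + d12) (t13 : d01 ≤ d03 + d13) (t21 : d02 ≤ d01 + d12) (t23 : d02 ≤ d03 + d23)
    (t31 : d03 ≤ d01 + d13) (t32 : d03 ≤ d02 + d23)
    (B1 : T ≤ P * Real.exp (-(κ * ((min d01 (min d12 d13) : ℕ) : ℝ))))
    (B2 : T ≤ P * Real.exp (-(κ * ((min d02 (min d12 d23) : ℕ) : ℝ))))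
    (B3 : T ≤ P * Real.exp (-(κ * ((min d03 (min d13 d23) : ℕ) : ℝ))))
    (B12 : T ≤ P * Real.exp (-(κ * ((min d01 (min d02 (min d13 d23)) : ℕ) : ℝ))))
    (B13 : T ≤ P * Real.exp (-(κ * ((min d01 (min d03 (min d12 d23)) : ℕ) : ℝ))))
    (B23 : T ≤ P * Real.exp (-(κ * ((min d02 (min d03 (min d12 d13)) : ℕ) : ℝ))))
    (B123 : T ≤ P * Real.exp (-(κ * ((min d01 (min d02 d03) : ℕ) : ℝ)))) :
    T ≤ P * Real.exp (-(κ / 9 * d01)) * Real.exp (-(κ / 9 * d02)) * Real.exp (-(κ / 9 * d03)) := by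
  -- the antitone envelope and the largest gap
  set Φ : ℝ → ℝ := fun x => P * Real.exp (-(κ * x)) with hΦ
  have hanti : Antitone Φ := by
    intro x y hxy
    simp only [hΦ]
    exact mul_le_mul_of_nonneg_left (Real.exp_le_exp.2 (by nlinarith)) hP
  push_cast at B1 B2 B3 B12 B13 B23 B123
  set G : ℝ := max (min (d01 : ℝ) (min (d12 : ℝ) d13)) (max (min (d02 : ℝ) (min (d12 : ℝ) d23))
    (max (min (d03 : ℝ) (min (d13 : ℝ) d23)) (max (min (d01 : ℝ) (min (d02 : ℝ) (min (d13 : ℝ) d23)))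
    (max (min (d01 : ℝ) (min (d03 : ℝ) (min (d12 : ℝ) d23))) (max (min (d02 : ℝ) (min (d03 : ℝ) (min (d12 : ℝ) d13)))
    (min (d01 : ℝ) (min (d02 : ℝ) d03))))))) with hG
  have hTG : T ≤ Φ G := by
    rw [hG, hanti.map_max, hanti.map_max, hanti.map_max, hanti.map_max, hanti.map_max, hanti.map_max]
    exact le_min B1 (le_min B2 (le_min B3 (le_min B12 (le_min B13 (le_min B23 B123)))))
  -- all gaps are `≤ G`
  have l1 : min (d01 : ℝ) (min (d12 : ℝ) d13) ≤ G := le_max_left _ _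
  have l2 : min (d02 : ℝ) (min (d12 : ℝ) d23) ≤ G := (le_max_left _ _).trans (le_max_right _ _)
  have l3 : min (d03 : ℝ) (min (d13 : ℝ) d23) ≤ G :=
    (le_max_left _ _).trans ((le_max_right _ _).trans (le_max_right _ _))
  have l12 : min (d01 : ℝ) (min (d02 : ℝ) (min (d13 : ℝ) d23)) ≤ G :=
    (le_max_left _ _).trans ((le_max_right _ _).trans ((le_max_right _ _).trans (le_max_right _ _)))
  have l13 : min (d01 : ℝ) (min (d03 : ℝ) (min (d12 : ℝ) d23)) ≤ G :=
    (le_max_left _ _).trans ((le_max_right _ _).trans ((le_max_right _ _).trans ((le_max_right _ _).trans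
      (le_max_right _ _))))
  have l23 : min (d02 : ℝ) (min (d03 : ℝ) (min (d12 : ℝ) d13)) ≤ G :=
    (le_max_left _ _).trans ((le_max_right _ _).trans ((le_max_right _ _).trans ((le_max_right _ _).trans
      ((le_max_right _ _).trans (le_max_right _ _)))))
  have l123 : min (d01 : ℝ) (min (d02 : ℝ) d03) ≤ G :=
    (le_max_right _ _).trans ((le_max_right _ _).trans ((le_max_right _ _).trans ((le_max_right _ _).trans
      ((le_max_right _ _).trans (le_max_right _ _)))))
  have hG0 : 0 ≤ G := le_trans (le_min (Nat.cast_nonneg _) (le_min (Nat.cast_nonneg _) (Nat.cast_nonneg _))) l1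
  have t12' : (d01 : ℝ) ≤ d02 + d12 := by exact_mod_cast t12
  have t13' : (d01 : ℝ) ≤ d03 + d13 := by exact_mod_cast t13
  have t21' : (d02 : ℝ) ≤ d01 + d12 := by exact_mod_cast t21
  have t23' : (d02 : ℝ) ≤ d03 + d23 := by exact_mod_cast t23
  have t31' : (d03 : ℝ) ≤ d01 + d13 := by exact_mod_cast t31
  have t32' : (d03 : ℝ) ≤ d02 + d23 := by exact_mod_cast t32
  obtain ⟨h1, h2, h3⟩ := dist_le_three_mul_of_gaps_le t12' t13' t21' t23' t31' t32' l1 l2 l3 l12 l13 l23 l123 hG0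
  calc T ≤ Φ G := hTG
    _ ≤ Φ (((d01 : ℝ) + d02 + d03) / 9) := hanti (by linarith)
    _ = P * Real.exp (-(κ / 9 * d01)) * Real.exp (-(κ / 9 * d02)) * Real.exp (-(κ / 9 * d03)) := by
        simp only [hΦ]
        rw [mul_assoc, mul_assoc, ← Real.exp_add, ← Real.exp_add]
        congr 1; ring

end Seven

/-! ### §3 Tree decay of the connected four-point function -/

section FourPoint

/-- Local shorthand: the normalised plaquette observable `W_q = ½ Re tr U_q` of `SU(2)` on `ℤ⁴`. -/
local notation3 (prettyPrint := false) "W∗" q:max =>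
  zdPlaquetteObs (d := 4) (fundamentalRep (Fin 2)) (Prod.fst q) (Prod.snd q).1.1 (Prod.snd q).1.2

/-- Local shorthand: the connected three-point function `u₃(X; Y; Z)` under `μ`. -/
local notation3 (prettyPrint := false) "U₃[" X ";" Y ";" Z ";" μ "]" =>
  cov[fun ω => X ω * Y ω, Z; μ] - (∫ ω, X ω ∂μ) * cov[Y, Z; μ] - (∫ ω, Y ω ∂μ) * cov[X, Z; μ]

/-- Local shorthand: the connected four-point function in derivative form `u₄(X; Y; Z; W)` under `μ`. -/
local notation3 (prettyPrint := false) "U₄[" X ";" Y ";" Z ";" W ";" μ "]" =>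
  (cov[fun ω => (X ω * Y ω) * Z ω, W; μ] - (∫ ω, X ω * Y ω ∂μ) * cov[Z, W; μ] - (∫ ω, Z ω ∂μ) * cov[fun ω => X ω * Y ω, W; μ])
  - cov[X, W; μ] * cov[Y, Z; μ] - (∫ ω, X ω ∂μ) * U₃[Y ; Z ; W ; μ]
  - cov[Y, W; μ] * cov[X, Z; μ] - (∫ ω, Y ω ∂μ) * U₃[X ; Z ; W ; μ]

/-- `e^{−(κ/9)‖z‖_∞} ≤ (e^{−κ/36})^{‖z‖₁}` on `ℤ⁴`. [folklore] -/
theorem exp_neg_ninth_supNorm_le_pow {κ : ℝ} (hκ : 0 ≤ κ) (z : Literature.Probability.LatticeModels.Site 4) :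
    Real.exp (-(κ / 9 * ‖z‖)) ≤ Real.exp (-(κ / 36)) ^ l1 z := by
  have h := exp_neg_quarter_supNorm_le_pow (κ := 4 * κ / 9) (by positivity) z
  have e1 : 4 * κ / 9 / 4 = κ / 9 := by ring
  have e2 : 4 * κ / 9 / 16 = κ / 36 := by ring
  rw [e1, e2] at h
  exact h

/-- ★ **TREE DECAY OF THE CONNECTED FOUR-POINT FUNCTION** (`SU(2)`, `d = 4`, hypothesis-free, ONE constant for the whole
window).  For `β₁ ≤ 9/25`, `κ = starRate (R_G β₁)`, `ρ = e^{−κ/36}`, a Lipschitz cylinder `F` (support `Λ`, constant `K`, links based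
within sup-distance `D` of `x₀`), the DLR state `μ` at any `0 ≤ β_W ≤ β₁`, and all plaquettes `q, r, s` of `ℤ⁴`:
`|u₄(F; W_q; W_r; W_s)| ≤ A₄ · ρ^{‖x₀−x_q‖₁} ρ^{‖x₀−x_r‖₁} ρ^{‖x₀−x_s‖₁}`,
`A₄ = 4(2√2)² e^{κ(D+4)} · 40 (#Λ+4)² (|F 1|+2K+1)² (K+32)²` — seven bipartitions (`su2_abs_fourPoint_le_of_isolated/_of_pair`
through the transpositions of `ConnectedFourPointAlgebra`) and `tree_bound_of_seven_splits`. -/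
theorem su2_abs_fourPoint_le {β₁ : ℝ} (h1 : β₁ ≤ 9 / 25) {βW : ℝ} (h0 : 0 ≤ βW) (hβ : βW ≤ β₁)
    {μ : Measure (LGConfig 4 (Matrix.specialUnitaryGroup (Fin 2) ℂ))}
    (hμ : μ ∈ ymGibbsMeasures (d := 4) (fundamentalRep (Fin 2)) (2 * (βW / 4)))
    {F : LGConfig 4 (Matrix.specialUnitaryGroup (Fin 2) ℂ) → ℝ} {Λ : Finset (ZdEdge 4)} {K : ℝ≥0}
    (hF : IsLipschitzCylinder (fundamentalRep (Fin 2)) F Λ K)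
    {x₀ : Literature.Probability.LatticeModels.Site 4} {D : ℕ} (hD : ∀ e ∈ Λ, ‖e.1 - x₀‖ ≤ D)
    (q r s : ZdPlaquette 4) :
    |U₄[F ; W∗ q ; W∗ r ; W∗ s ; μ]| ≤
      4 * (2 * Real.sqrt 2) ^ 2 * Real.exp (starRate (gaugeR β₁) * (D + 4)) *
        (40 * ((Λ.card : ℝ) + 4) ^ 2 * (|F 1| + 2 * K + 1) ^ 2 * ((K : ℝ) + 32) ^ 2) *
        Real.exp (-(starRate (gaugeR β₁) / 36)) ^ l1 (x₀ - q.1) * Real.exp (-(starRate (gaugeR β₁) / 36)) ^ l1 (x₀ - r.1) *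
        Real.exp (-(starRate (gaugeR β₁) / 36)) ^ l1 (x₀ - s.1) := by
  classical
  haveI : IsProbabilityMeasure μ := hμ.1
  have hβ₁0 : 0 ≤ β₁ := h0.trans hβ
  have hκ : 0 < starRate (gaugeR β₁) :=
    starRate_pos (gaugeR_nonneg hβ₁0 (by linarith)) (gaugeR_lt_one_of_le hβ₁0 h1)
  obtain ⟨hWq, hWqm, hWq1, hq1, -⟩ := su2_plaquetteObs_data q
  obtain ⟨hWr, hWrm, hWr1, hr1, -⟩ := su2_plaquetteObs_data r
  obtain ⟨hWs, hWsm, hWs1, hs1, -⟩ := su2_plaquetteObs_data s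
  -- uniform data `(n, L, M)` as opaque names
  obtain ⟨MF, hMFdef⟩ : ∃ M : ℝ≥0, (M : ℝ) = |F 1| + 2 * K := ⟨⟨|F 1| + 2 * K, by positivity⟩, rfl⟩
  have hFM : ∀ U, |F U| ≤ (MF : ℝ) := fun U => by rw [hMFdef]; exact hF.abs_le U
  obtain ⟨nN, hnN⟩ : ∃ n : ℕ, n = Λ.card + 4 := ⟨_, rfl⟩
  obtain ⟨LN, hLN⟩ : ∃ L : ℝ≥0, L = K + 4 * (2 : ℝ≥0) ^ 3 := ⟨_, rfl⟩
  obtain ⟨MN, hMN⟩ : ∃ M : ℝ≥0, M = MF + 1 := ⟨_, rfl⟩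
  have hnF : Λ.card ≤ nN := by omega
  have hnq : (plaquetteEdges q).card ≤ nN := (card_plaquetteEdges_le q).trans (by omega)
  have hnr : (plaquetteEdges r).card ≤ nN := (card_plaquetteEdges_le r).trans (by omega)
  have hns : (plaquetteEdges s).card ≤ nN := (card_plaquetteEdges_le s).trans (by omega)
  have hLF : K ≤ LN := by rw [hLN]; exact le_add_of_nonneg_right (by positivity)
  have hLW : (4 * (2 : ℝ≥0) ^ 3) ≤ LN := by rw [hLN]; exact le_add_of_nonneg_left (by positivity)
  have hMF' : MF ≤ MN := by rw [hMN]; exact le_add_of_nonneg_right zero_le_one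
  have hMW : (1 : ℝ≥0) ≤ MN := by rw [hMN]; exact le_add_of_nonneg_left (by positivity)
  -- base-point distances
  obtain ⟨d01, hd01⟩ : ∃ n : ℕ, n = Literature.Probability.LatticeModels.Site.supNorm (x₀ - q.1) := ⟨_, rfl⟩
  obtain ⟨d02, hd02⟩ : ∃ n : ℕ, n = Literature.Probability.LatticeModels.Site.supNorm (x₀ - r.1) := ⟨_, rfl⟩
  obtain ⟨d03, hd03⟩ : ∃ n : ℕ, n = Literature.Probability.LatticeModels.Site.supNorm (x₀ - s.1) := ⟨_, rfl⟩
  obtain ⟨d12, hd12⟩ : ∃ n : ℕ, n = Literature.Probability.LatticeModels.Site.supNorm (q.1 - r.1) := ⟨_, rfl⟩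
  obtain ⟨d13, hd13⟩ : ∃ n : ℕ, n = Literature.Probability.LatticeModels.Site.supNorm (q.1 - s.1) := ⟨_, rfl⟩
  obtain ⟨d23, hd23⟩ : ∃ n : ℕ, n = Literature.Probability.LatticeModels.Site.supNorm (r.1 - s.1) := ⟨_, rfl⟩
  have R01 : ‖x₀ - q.1‖ = d01 := by rw [hd01]; exact Literature.Probability.LatticeModels.Site.norm_eq_supNorm _
  have R02 : ‖x₀ - r.1‖ = d02 := by rw [hd02]; exact Literature.Probability.LatticeModels.Site.norm_eq_supNorm _
  have R03 : ‖x₀ - s.1‖ = d03 := by rw [hd03]; exact Literature.Probability.LatticeModels.Site.norm_eq_supNorm _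
  have R12 : ‖q.1 - r.1‖ = d12 := by rw [hd12]; exact Literature.Probability.LatticeModels.Site.norm_eq_supNorm _
  have R13 : ‖q.1 - s.1‖ = d13 := by rw [hd13]; exact Literature.Probability.LatticeModels.Site.norm_eq_supNorm _
  have R23 : ‖r.1 - s.1‖ = d23 := by rw [hd23]; exact Literature.Probability.LatticeModels.Site.norm_eq_supNorm _
  have nsym : ∀ (u v : Literature.Probability.LatticeModels.Site 4),
      Literature.Probability.LatticeModels.Site.supNorm (v - u) = Literature.Probability.LatticeModels.Site.supNorm (u - v) := by
    intro u v
    have h1 : ‖v - u‖ = (Literature.Probability.LatticeModels.Site.supNorm (v - u) : ℝ) :=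
      Literature.Probability.LatticeModels.Site.norm_eq_supNorm _
    have h2 : ‖u - v‖ = (Literature.Probability.LatticeModels.Site.supNorm (u - v) : ℝ) :=
      Literature.Probability.LatticeModels.Site.norm_eq_supNorm _
    rw [norm_sub_rev, h2] at h1
    exact_mod_cast h1.symm
  -- triangle inequalities through `x₀`
  have tri : ∀ {u v w : Literature.Probability.LatticeModels.Site 4} {a b c : ℕ},
      ‖u - v‖ = a → ‖u - w‖ = b → ‖v - w‖ = c → a ≤ b + c := by
    intro u v w a b c ha hb hc
    have h : ‖u - v‖ ≤ ‖u - w‖ + ‖v - w‖ := by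
      calc ‖u - v‖ = ‖(u - w) - (v - w)‖ := by congr 1; abel
        _ ≤ ‖u - w‖ + ‖v - w‖ := norm_sub_le _ _
    rw [ha, hb, hc] at h
    exact_mod_cast h
  have R21 : ‖r.1 - q.1‖ = d12 := by rw [norm_sub_rev]; exact R12
  have R31 : ‖s.1 - q.1‖ = d13 := by rw [norm_sub_rev]; exact R13
  have R32 : ‖s.1 - r.1‖ = d23 := by rw [norm_sub_rev]; exact R23
  have t12 : d01 ≤ d02 + d12 := tri R01 R02 R12
  have t13 : d01 ≤ d03 + d13 := tri R01 R03 R13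
  have t21 : d02 ≤ d01 + d12 := tri R02 R01 R21
  have t23 : d02 ≤ d03 + d23 := tri R02 R03 R23
  have t31 : d03 ≤ d01 + d13 := tri R03 R01 R31
  have t32 : d03 ≤ d02 + d23 := tri R03 R02 R32
  -- pairwise separations of the clusters
  have S01 : ∀ {m : ℕ}, m ≤ d01 - (D + 2) → ∀ a ∈ Λ, ∀ b ∈ plaquetteEdges q, (m : ℝ) ≤ ‖a.1 - b.1‖ :=
    fun hm => sep_of_near hD hq1 (by rw [← hd01]; omega)
  have S02 : ∀ {m : ℕ}, m ≤ d02 - (D + 2) → ∀ a ∈ Λ, ∀ b ∈ plaquetteEdges r, (m : ℝ) ≤ ‖a.1 - b.1‖ :=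
    fun hm => sep_of_near hD hr1 (by rw [← hd02]; omega)
  have S03 : ∀ {m : ℕ}, m ≤ d03 - (D + 2) → ∀ a ∈ Λ, ∀ b ∈ plaquetteEdges s, (m : ℝ) ≤ ‖a.1 - b.1‖ :=
    fun hm => sep_of_near hD hs1 (by rw [← hd03]; omega)
  have S10 : ∀ {m : ℕ}, m ≤ d01 - (D + 2) → ∀ a ∈ plaquetteEdges q, ∀ b ∈ Λ, (m : ℝ) ≤ ‖a.1 - b.1‖ :=
    fun hm => sep_of_near hq1 hD (by rw [nsym, ← hd01]; omega)
  have S20 : ∀ {m : ℕ}, m ≤ d02 - (D + 2) → ∀ a ∈ plaquetteEdges r, ∀ b ∈ Λ, (m : ℝ) ≤ ‖a.1 - b.1‖ :=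
    fun hm => sep_of_near hr1 hD (by rw [nsym, ← hd02]; omega)
  have S30 : ∀ {m : ℕ}, m ≤ d03 - (D + 2) → ∀ a ∈ plaquetteEdges s, ∀ b ∈ Λ, (m : ℝ) ≤ ‖a.1 - b.1‖ :=
    fun hm => sep_of_near hs1 hD (by rw [nsym, ← hd03]; omega)
  have S12 : ∀ {m : ℕ}, m ≤ d12 - (D + 2) → ∀ a ∈ plaquetteEdges q, ∀ b ∈ plaquetteEdges r, (m : ℝ) ≤ ‖a.1 - b.1‖ :=
    fun hm => sep_of_near hq1 hr1 (by rw [← hd12]; omega)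
  have S21 : ∀ {m : ℕ}, m ≤ d12 - (D + 2) → ∀ a ∈ plaquetteEdges r, ∀ b ∈ plaquetteEdges q, (m : ℝ) ≤ ‖a.1 - b.1‖ :=
    fun hm => sep_of_near hr1 hq1 (by rw [nsym, ← hd12]; omega)
  have S13 : ∀ {m : ℕ}, m ≤ d13 - (D + 2) → ∀ a ∈ plaquetteEdges q, ∀ b ∈ plaquetteEdges s, (m : ℝ) ≤ ‖a.1 - b.1‖ :=
    fun hm => sep_of_near hq1 hs1 (by rw [← hd13]; omega)
  have S31 : ∀ {m : ℕ}, m ≤ d13 - (D + 2) → ∀ a ∈ plaquetteEdges s, ∀ b ∈ plaquetteEdges q, (m : ℝ) ≤ ‖a.1 - b.1‖ :=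
    fun hm => sep_of_near hs1 hq1 (by rw [nsym, ← hd13]; omega)
  have S23 : ∀ {m : ℕ}, m ≤ d23 - (D + 2) → ∀ a ∈ plaquetteEdges r, ∀ b ∈ plaquetteEdges s, (m : ℝ) ≤ ‖a.1 - b.1‖ :=
    fun hm => sep_of_near hr1 hs1 (by rw [← hd23]; omega)
  have S32 : ∀ {m : ℕ}, m ≤ d23 - (D + 2) → ∀ a ∈ plaquetteEdges s, ∀ b ∈ plaquetteEdges r, (m : ℝ) ≤ ‖a.1 - b.1‖ :=
    fun hm => sep_of_near hs1 hr1 (by rw [nsym, ← hd23]; omega)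
  have U2 : ∀ {S₁ S₂ T : Finset (ZdEdge 4)} {m : ℕ}, (∀ a ∈ S₁, ∀ b ∈ T, (m : ℝ) ≤ ‖a.1 - b.1‖) →
      (∀ a ∈ S₂, ∀ b ∈ T, (m : ℝ) ≤ ‖a.1 - b.1‖) → ∀ a ∈ S₁ ∪ S₂, ∀ b ∈ T, (m : ℝ) ≤ ‖a.1 - b.1‖ :=
    fun h₁ h₂ => Finset.forall_mem_union.2 ⟨h₁, h₂⟩
  have T2 : ∀ {S T₁ T₂ : Finset (ZdEdge 4)} {m : ℕ}, (∀ a ∈ S, ∀ b ∈ T₁, (m : ℝ) ≤ ‖a.1 - b.1‖) →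
      (∀ a ∈ S, ∀ b ∈ T₂, (m : ℝ) ≤ ‖a.1 - b.1‖) → ∀ a ∈ S, ∀ b ∈ T₁ ∪ T₂, (m : ℝ) ≤ ‖a.1 - b.1‖ :=
    fun h₁ h₂ a ha => Finset.forall_mem_union.2 ⟨h₁ a ha, h₂ a ha⟩
  -- the common constant after the truncation bookkeeping
  obtain ⟨P₀, hP₀⟩ : ∃ P : ℝ, P = 4 * (2 * Real.sqrt 2) ^ 2 * Real.exp (starRate (gaugeR β₁) * (D + 4)) *
      (40 * (nN : ℝ) ^ 2 * (MN : ℝ) ^ 2 * (LN : ℝ) ^ 2) := ⟨_, rfl⟩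
  have hP₀0 : 0 ≤ P₀ := by rw [hP₀]; positivity
  have pack : ∀ {g : ℕ} {c : ℝ}, 0 ≤ c → c ≤ 40 →
      |U₄[F ; W∗ q ; W∗ r ; W∗ s ; μ]| ≤ 4 * (2 * Real.sqrt 2) ^ 2 *
        Real.exp (-(starRate (gaugeR β₁) * (((g - (D + 2) : ℕ) - 2 : ℕ) : ℝ))) * (c * (nN : ℝ) ^ 2 * (MN : ℝ) ^ 2 * (LN : ℝ) ^ 2) →
      |U₄[F ; W∗ q ; W∗ r ; W∗ s ; μ]| ≤ P₀ * Real.exp (-(starRate (gaugeR β₁) * g)) := by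
    intro g c hc0 hc h
    refine h.trans ?_
    rw [hP₀]
    have he := exp_trunc_sub_le hκ.le g D
    have hq : (0 : ℝ) ≤ (nN : ℝ) ^ 2 * (MN : ℝ) ^ 2 * (LN : ℝ) ^ 2 := by positivity
    have hcq : 0 ≤ c * (nN : ℝ) ^ 2 * (MN : ℝ) ^ 2 * (LN : ℝ) ^ 2 := by
      have := mul_nonneg hc0 hq; linarith [this, show c * (nN : ℝ) ^ 2 * (MN : ℝ) ^ 2 * (LN : ℝ) ^ 2 =
        c * ((nN : ℝ) ^ 2 * (MN : ℝ) ^ 2 * (LN : ℝ) ^ 2) by ring]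
    have hc' : c * (nN : ℝ) ^ 2 * (MN : ℝ) ^ 2 * (LN : ℝ) ^ 2 ≤ 40 * (nN : ℝ) ^ 2 * (MN : ℝ) ^ 2 * (LN : ℝ) ^ 2 := by
      have h' := mul_le_mul_of_nonneg_right hc hq
      calc c * (nN : ℝ) ^ 2 * (MN : ℝ) ^ 2 * (LN : ℝ) ^ 2 = c * ((nN : ℝ) ^ 2 * (MN : ℝ) ^ 2 * (LN : ℝ) ^ 2) := by ring
        _ ≤ 40 * ((nN : ℝ) ^ 2 * (MN : ℝ) ^ 2 * (LN : ℝ) ^ 2) := h'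
        _ = _ := by ring
    have hA : (0 : ℝ) ≤ 4 * (2 * Real.sqrt 2) ^ 2 := by positivity
    have h2 : 0 ≤ 4 * (2 * Real.sqrt 2) ^ 2 * (Real.exp (starRate (gaugeR β₁) * (D + 4)) *
        Real.exp (-(starRate (gaugeR β₁) * g))) := by positivity
    calc 4 * (2 * Real.sqrt 2) ^ 2 * Real.exp (-(starRate (gaugeR β₁) * (((g - (D + 2) : ℕ) - 2 : ℕ) : ℝ))) *
          (c * (nN : ℝ) ^ 2 * (MN : ℝ) ^ 2 * (LN : ℝ) ^ 2)
        ≤ 4 * (2 * Real.sqrt 2) ^ 2 * (Real.exp (starRate (gaugeR β₁) * (D + 4)) * Real.exp (-(starRate (gaugeR β₁) * g))) *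
          (c * (nN : ℝ) ^ 2 * (MN : ℝ) ^ 2 * (LN : ℝ) ^ 2) :=
          mul_le_mul_of_nonneg_right (mul_le_mul_of_nonneg_left he hA) hcq
      _ ≤ 4 * (2 * Real.sqrt 2) ^ 2 * (Real.exp (starRate (gaugeR β₁) * (D + 4)) * Real.exp (-(starRate (gaugeR β₁) * g))) *
          (40 * (nN : ℝ) ^ 2 * (MN : ℝ) ^ 2 * (LN : ℝ) ^ 2) := mul_le_mul_of_nonneg_left hc' h2
      _ = _ := by ring
  -- the seven bounds
  have B3 := pack (g := min d03 (min d13 d23)) (by norm_num) (by norm_num)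
    (su2_abs_fourPoint_le_of_isolated h1 h0 hβ hμ hF hWq hWr hWs hFM hWq1 hWr1 hnF hnq hnr hns hLF hLW hLW hLW hMF' hMW hMW
      (U2 (U2 (S03 (by omega)) (S13 (by omega))) (S23 (by omega))))
  have B2 : |U₄[F ; W∗ q ; W∗ r ; W∗ s ; μ]| ≤ P₀ * Real.exp (-(starRate (gaugeR β₁) * (min d02 (min d12 d23) : ℕ))) := by
    have h := su2_abs_fourPoint_le_of_isolated h1 h0 hβ hμ hF hWq hWs hWr hFM hWq1 hWs1 hnF hnq hns hnr hLF hLW hLW hLW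
      hMF' hMW hMW (m := min d02 (min d12 d23) - (D + 2)) (U2 (U2 (S02 (by omega)) (S12 (by omega))) (S32 (by omega)))
    rw [← fourPoint_swap_zw hF.measurable hWqm hWrm hWsm hFM hWq1 hWr1 hWs1] at h
    exact pack (by norm_num) (by norm_num) h
  have B1 : |U₄[F ; W∗ q ; W∗ r ; W∗ s ; μ]| ≤ P₀ * Real.exp (-(starRate (gaugeR β₁) * (min d01 (min d12 d13) : ℕ))) := by
    have h := su2_abs_fourPoint_le_of_isolated h1 h0 hβ hμ hF hWr hWs hWq hFM hWr1 hWs1 hnF hnr hns hnq hLF hLW hLW hLW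
      hMF' hMW hMW (m := min d01 (min d12 d13) - (D + 2)) (U2 (U2 (S01 (by omega)) (S21 (by omega))) (S31 (by omega)))
    rw [← fourPoint_swap_zw hF.measurable hWrm hWqm hWsm hFM hWr1 hWq1 hWs1,
      ← fourPoint_swap_yz hF.measurable hWqm hWrm hWsm hFM hWq1 hWr1 hWs1] at h
    exact pack (by norm_num) (by norm_num) h
  have B123 : |U₄[F ; W∗ q ; W∗ r ; W∗ s ; μ]| ≤ P₀ * Real.exp (-(starRate (gaugeR β₁) * (min d01 (min d02 d03) : ℕ))) := by
    have h := su2_abs_fourPoint_le_of_isolated h1 h0 hβ hμ hWq hWr hWs hF hWq1 hWr1 hWs1 hnq hnr hns hnF hLW hLW hLW hLF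
      hMW hMW hMW (m := min d01 (min d02 d03) - (D + 2)) (U2 (U2 (S10 (by omega)) (S20 (by omega))) (S30 (by omega)))
    rw [← fourPoint_swap_zw hWqm hWrm hF.measurable hWsm hWq1 hWr1 hFM hWs1,
      ← fourPoint_swap_yz hWqm hF.measurable hWrm hWsm hWq1 hFM hWr1 hWs1,
      ← fourPoint_swap_xy hF.measurable hWqm hWrm hWsm hFM hWq1 hWr1 hWs1] at h
    exact pack (by norm_num) (by norm_num) h
  have B23 := pack (g := min d02 (min d03 (min d12 d13))) (by norm_num) (le_refl (40 : ℝ))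
    (su2_abs_fourPoint_le_of_pair h1 h0 hβ hμ hF hWq hWr hWs hFM hWq1 hWr1 hWs1 hnF hnq hnr hns hLF hLW hLW hLW hMF' hMW hMW hMW
      (U2 (T2 (S02 (by omega)) (S03 (by omega))) (T2 (S12 (by omega)) (S13 (by omega)))))
  have B13 : |U₄[F ; W∗ q ; W∗ r ; W∗ s ; μ]| ≤
      P₀ * Real.exp (-(starRate (gaugeR β₁) * (min d01 (min d03 (min d12 d23)) : ℕ))) := by
    have h := su2_abs_fourPoint_le_of_pair h1 h0 hβ hμ hF hWr hWq hWs hFM hWr1 hWq1 hWs1 hnF hnr hnq hns hLF hLW hLW hLW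
      hMF' hMW hMW hMW (m := min d01 (min d03 (min d12 d23)) - (D + 2))
      (U2 (T2 (S01 (by omega)) (S03 (by omega))) (T2 (S21 (by omega)) (S23 (by omega))))
    rw [← fourPoint_swap_yz hF.measurable hWqm hWrm hWsm hFM hWq1 hWr1 hWs1] at h
    exact pack (by norm_num) le_rfl h
  have B12 : |U₄[F ; W∗ q ; W∗ r ; W∗ s ; μ]| ≤
      P₀ * Real.exp (-(starRate (gaugeR β₁) * (min d01 (min d02 (min d13 d23)) : ℕ))) := by
    have h := su2_abs_fourPoint_le_of_pair h1 h0 hβ hμ hF hWs hWq hWr hFM hWs1 hWq1 hWr1 hnF hns hnq hnr hLF hLW hLW hLW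
      hMF' hMW hMW hMW (m := min d01 (min d02 (min d13 d23)) - (D + 2))
      (U2 (T2 (S01 (by omega)) (S02 (by omega))) (T2 (S31 (by omega)) (S32 (by omega))))
    rw [← fourPoint_swap_yz hF.measurable hWqm hWsm hWrm hFM hWq1 hWs1 hWr1,
      ← fourPoint_swap_zw hF.measurable hWqm hWrm hWsm hFM hWq1 hWr1 hWs1] at h
    exact pack (by norm_num) le_rfl h
  -- combine the seven splits
  have key := tree_bound_of_seven_splits hP₀0 hκ.le t12 t13 t21 t23 t31 t32 B1 B2 B3 B12 B13 B23 B123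
  refine key.trans ?_
  have e1 := exp_neg_ninth_supNorm_le_pow hκ.le (x₀ - q.1)
  have e2 := exp_neg_ninth_supNorm_le_pow hκ.le (x₀ - r.1)
  have e3 := exp_neg_ninth_supNorm_le_pow hκ.le (x₀ - s.1)
  rw [R01] at e1; rw [R02] at e2; rw [R03] at e3
  have hfin : P₀ = 4 * (2 * Real.sqrt 2) ^ 2 * Real.exp (starRate (gaugeR β₁) * (D + 4)) *
      (40 * ((Λ.card : ℝ) + 4) ^ 2 * (|F 1| + 2 * K + 1) ^ 2 * ((K : ℝ) + 32) ^ 2) := by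
    rw [hP₀]
    have en : (nN : ℝ) = Λ.card + 4 := by rw [hnN]; push_cast; ring
    have eL : (LN : ℝ) = K + 32 := by rw [hLN]; push_cast; norm_num
    have eM : (MN : ℝ) = |F 1| + 2 * K + 1 := by rw [hMN]; push_cast; rw [hMFdef]
    rw [en, eL, eM]
  rw [← hfin]
  have hρ0 : 0 ≤ Real.exp (-(starRate (gaugeR β₁) / 36)) := (Real.exp_pos _).le
  calc P₀ * Real.exp (-(starRate (gaugeR β₁) / 9 * d01)) * Real.exp (-(starRate (gaugeR β₁) / 9 * d02)) *
        Real.exp (-(starRate (gaugeR β₁) / 9 * d03))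
      ≤ P₀ * Real.exp (-(starRate (gaugeR β₁) / 36)) ^ l1 (x₀ - q.1) * Real.exp (-(starRate (gaugeR β₁) / 36)) ^ l1 (x₀ - r.1) *
        Real.exp (-(starRate (gaugeR β₁) / 36)) ^ l1 (x₀ - s.1) := by
        gcongr

end FourPoint

end Summit.Ventures.YMGap.CouplingResponse

end
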